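import Literature.MathematicalPhysics.QuantumFieldTheory.ConformalBootstrap3D.PointKernelK34v2Data

/-!
# K34v2 certificate, kernel block file H9: head segments `122 ≤ i < 184` (block-checked ones)

`decide` by kernel reduction (no `native_decide`, no extra axioms) of the block checker
`PCert.hBlockOK` of `PointKernel` on the literal data of `PointKernelK34v2Data` (cells checked corner
or chord by the rule bit); soundness is `PCert.hBlockOK_sound`.  Estimated kernel time 246 s
(5 theorems).
-/

set_option maxRecDepth 100000
set_option maxHeartbeats 0

namespace Literature.MathematicalPhysics.QuantumFieldTheory.ConformalBootstrap3D.PointKernelK34v2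

open Literature.MathematicalPhysics.QuantumFieldTheory.ConformalBootstrap3D.PointKernel

/-- head segments `[122, 124)` pass the kernel evaluator (≈40 s of kernel work). [folklore] -/
theorem hBlock_122 : certK34v2.hBlockOK hsegsK34v2 122 124 JHK34v2 = true := by
  decide +kernel

/-- head segments `[124, 129)` pass the kernel evaluator (≈23 s of kernel work). [folklore] -/
theorem hBlock_124 : certK34v2.hBlockOK hsegsK34v2 124 129 JHK34v2 = true := by
  decide +kernel

/-- head segments `[129, 137)` pass the kernel evaluator (≈8 s of kernel work). [folklore] -/
theorem hBlock_129 : certK34v2.hBlockOK hsegsK34v2 129 137 JHK34v2 = true := by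
  decide +kernel

/-- head segments `[137, 139)` pass the kernel evaluator (≈0 s of kernel work). [folklore] -/
theorem hBlock_137 : certK34v2.hBlockOK hsegsK34v2 137 139 JHK34v2 = true := by
  decide +kernel

/-- head segment `[183, 184)` passes the kernel evaluator (≈45 s of kernel work). [folklore] -/
theorem hBlock_183 : certK34v2.hBlockOK hsegsK34v2 183 184 JHK34v2 = true := by
  decide +kernel

end Literature.MathematicalPhysics.QuantumFieldTheory.ConformalBootstrap3D.PointKernelK34v2
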